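import Literature.MathematicalPhysics.QuantumFieldTheory.Balaban1983to89.B5Eq123ChangeOfGaugeV1

/-!
# `Balaban1983to89.B5Eq164LandauV1` — T. Bałaban, *Propagators and renormalization transformations for lattice gauge theories. I*,
Commun. Math. Phys. **95** (1984) 17–40 [Balaban1984PropagatorsI], Sect. D pp. 26–29: the Landau-gauge integral (1.47) and its evaluation
(1.64) «we make the translation A = A′ + H_kB … (1.47) = Z_k exp(−½⟨∂H_kB, ∂H_kB⟩)» PROVED AS PRINTED ON THE V1 LATTICE CALCULUS, with the
minimizer `H_kB` of [BalabanImbrieJaffe1985] (4.4.2) (seat p11's `Hk (opsV1 P k c s)`); (1.46) on V1; and (1.47) for `(ST)^k e^{−S}` on V1, both by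
evaluation ((1.19)/(1.64)/(1.65)) and by the printed route (1.17) → (1.23) → (1.46)/(1.47) (the Landau δ-function inserted in the Faddeev–Popov formula)

statement-level skeleton of published theorems with citation tags; proofs where landed; nothing here is a claim about the Yang–Mills mass gap

PDF held: `paper:balaban1984-cmp95-propagators-rt-i` (journal page = PDF page + 16), pp. 26, 29 [PDF 10, 13], materialised text.

PRINT, verbatim.  p. 26: «In the sequel it will be convenient to take the limit α → 0, i.e. to consider Landau gauge. We may introduce this gauge
from the beginning using the equation  ∫dλ δ(Q′_kλ)|det(Δ↾_{N(Q′_k)})|δ_R(∂*A − Δλ) = 1.  (1.46)  We have to calculate the integral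
((ST)^k e^{−S})(B) = z′^{(k)}|det(Δ↾_{N(Q′_k)})|∫dA δ(B − Q_kA)δ_R(∂*A) exp(−½⟨∂A, ∂A⟩).  (1.47)  With this integral an operator of fundamental
importance is connected. … its value on such a configuration is equal to a configuration A on T_η minimizing the form ½⟨∂A, ∂A⟩ under the
conditions Q_kA = B, R∂*A = 0.»  p. 29: «we can verify all the properties of H_kB: Q_kH_kB = B, R∂*H_kB = 0, H_kB is a minimum of ½⟨∂A, ∂A⟩ on
the hyperplane {A : Q_kA = B, R∂*A = 0}, which means that ⟨∂A′, ∂H_kB⟩ = 0 on the subspace {A′ : Q_kA′ = 0, R∂*A′ = 0}.  Let us now come back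
to the integral (1.47). We make the translation A = A′ + H_kB and using the above properties of H_kB, we get  (1.47) = Z_k exp(−½⟨∂H_kB, ∂H_kB⟩).
(1.64)  The action Δ_k is thus defined by ⟨B, Δ_kB⟩ = ⟨∂H_kB, ∂H_kB⟩.  (1.65)»

CITATION HEADER (lean-in-tree rule) — WHAT IS REPRODUCED.  Phase-2 proof file of the lit-balaban typed skeleton (HOME `run/shared/lean/pub/lit-balaban/`),
seat p38 (gen 3): V1 TWINS of the B5 owner's rows **B5.Eq1.64** ((1.64); torus decls of record `B5Eq165DeltaK.eq164` p16, `B5TowerOneStroke` p21 —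
untouched) and **B5.Eq1.47** ((1.46)–(1.47); torus `B5Eq147Landau.eq147_holds` p16 — untouched), complementing this seat's gen-2
`B5Eq165GaugeMinimaV1.eq164_landau` (which reaches the VALUE `Z_{k,Ax}e^{−½‖∂H_kB‖²}` of `(ST)^k e^{−S}` through the equality of minima, not
through the Landau-gauge INTEGRAL).  Carriers/objects BY NAME: `LatticeFieldCalculus` (r18), `B5Eq117CompositionV1.rtPow` = `(ST)^k` and
`B5Eq119GaussianV1.eq119/zAx/DeltaK` = (1.19) (p38 gen 2), the V1 instance `opsV1 P k c s` of [BalabanImbrieJaffe1985] Sect. 4.4 with `LandauOps.projR`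
= `R`, `kerQk` = `N(Q_k)`, `Hk` = `H_k`, `Hk_spec_V1`/`Hk_isLandauMinimizer_V1`/`noZeroModes_V1`/`energy_split_of_isMinOn` (p11), `partition_pos` (p09),
(1.65) on V1 `B5Eq165GaugeMinimaV1.eq165_landau` (p38 gen 2).  New definitions (with bodies): the Landau spaces `lan` = `{R∂*A = 0}`, `lanDir` =
`{A′ : Q_kA′ = 0, R∂*A′ = 0}`, the (1.47) integral `rt47` and its constant `Zk47`, the Landau slice ⊕ orbit coordinates `psiFun`/`psi`/`coordsL`
(`(A′, λ) ↦ A′ − ∂λ`, `lanDir × N(Q′_k) ≃ N(Q_k)`); §4 also uses BY NAME this seat's gen-3 `B5Eq123ChangeOfGaugeV1` (`resid` = `N(Q′_k)`, `fdir` =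
`N(Q_k)`, (1.22) `fp22`/`fp22_pos`, (1.23) `rt23`/`eq123`/`rt23_eq_fibInt`/`rt23_eq_Zk`, `injOn_lap_resid`), p22's engine
`B5ChangeOfGauge123.eq123_zprime` and (1.46) kernel `B5GaussSectC.integral_146` (`detN`, `Rop`, `Rsub`), gen-2 `B5Eq165GaugeMinimaV1.exists_landau_gauge`
/`half_norm_curl_sq`; no `Prop`-valued fact.

WHAT IS PROVED (kernel; standard axioms; `k ≤ m + K`, `c ≠ 0`, `s ≠ 0`; `∂ = s·curl c`, `S(A) = ½‖∂A‖² = ½Σ_p s²|(∂A)(p)|²`):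
`half_norm_curl_Hk_add_sq` («⟨∂A′, ∂H_kB⟩ = 0 on {Q_kA′ = 0, R∂*A′ = 0}» as `S(H_kB + A′) = S(H_kB) + S(A′)`); **`eq164`** — (1.64) AS PRINTED:
`∫dA δ(B − Q_kA)δ_R(∂*A)e^{−S(A)}` (based at `H_kB`) `= Z_k·exp(−½‖∂H_kB‖²)`, `Z_k = ∫_{lanDir} e^{−S(A′)}dA′`; `Zk47_pos` (`Z_k > 0`);
`rt47_eq_of_mem` (base-point independence of the (1.47) integral on the Landau fibre); **`eq147`** — (1.47) on V1: ONE `z″ > 0` with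
`((ST)^k e^{−S})(B) = z″·∫dA δ(B − Q_kA)δ_R(∂*A)e^{−S(A)}` for all `B` (via (1.19)/(1.64)/(1.65)); §4: **`eq146`** — (1.46) on V1 for an arbitrary
regularisation `φ` of `δ_R`: `∫_{N(Q′_k)}|det(Δ↾N(Q′_k))| φ(R∂*A^λ)dλ = ∫_R φ`; `psi_injective`/`psi_surjective`/`coordsL` (Landau gauge: existence and
uniqueness along residual orbits); **`rt47_eq_const_mul_rt23`** — (1.23) ⟹ (1.47): ONE `C > 0` with `rt47 = C·rt23(α)` for every `α > 0` (the δ_R slice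
of the Faddeev–Popov formula, p22's engine fed with `coordsL`); **`eq147_of_eq123`** — (1.47) by the printed route; `rt47_eq_const_mul_Zk` — the (1.47)
integral `∝` [BalabanImbrieJaffe1985] (4.4.3) `Z_k(B)`.

READINGS (none is an objection to print).  (a) `δ(B − Q_kA)δ_R(∂*A)dA` = the volume measure of the affine subspace `{Q_kA = B, R∂*A = 0}` of the
Euclidean bond-field space (the reading (1.40) p. 25 of the paper; convention of `B5GaussSectC`/`B5Eq147Landau`); the prefactor
`z′^{(k)}|det(Δ↾N(Q′_k))|` of (1.47) is a `B`-independent constant and is absorbed in `z″`.  (b) `H_k` is p11's (4.4.2) mean, identified with the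
(1.47)/(1.58)–(1.63) minimizer by `eq_Hk_of_isMinOn_curl_V1` (p11) — no second `H_k` is introduced.  HONEST SCOPE: (1.58)–(1.63) (the operator
formula for `H_k`) are not restated on V1 (tree, torus: `B5Hk160Torus`, `B5Hk163*`); torus statements of record untouched.

Unit `lit-balaban-p38` (literature-prover-lit-balaban-p38-g3-0), 2026-08-21.
-/

open scoped BigOperators RealInnerProductSpace

namespace Literature.MathematicalPhysics.QuantumFieldTheory.Balaban1983to89

namespace B5Eq164LandauV1

open LatticeFieldCalculus MeasureTheory B5Eq117CompositionV1 B5Eq119GaussianV1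
open Literature.MathematicalPhysics.QuantumFieldTheory.BalabanImbrieJaffe1984to88.BIJ85AxialPropagator411 (BondSpace PlaqSpace)
open Literature.MathematicalPhysics.QuantumFieldTheory.BalabanImbrieJaffe1984to88.BIJ85LandauForm441
open Literature.MathematicalPhysics.QuantumFieldTheory.BalabanImbrieJaffe1984to88.BIJ85LandauMinimizer442
open Literature.MathematicalPhysics.QuantumFieldTheory.BalabanImbrieJaffe1984to88.BIJ85LandauMinimizer442V1

noncomputable section

variable {P : Params} {k : ℕ} {c s : ℝ}

/-! ## 1. The Landau subspace «{A′ : Q_kA′ = 0, R∂*A′ = 0}» of p. 29 on V1 -/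

variable (P k c s) in
/-- **The Landau-gauge condition space `{A : R∂*A = 0}`** of (1.47) for the V1 instance `opsV1 P k c s` (`R` = the orthogonal projection onto
`ΔN(Q′_k)`, p11's `LandauOps.projR`). [cite: Balaban1984PropagatorsI, (1.47) p.26] -/
def lan : Submodule ℝ (BondSpace P) :=
  LinearMap.ker (((opsV1 P k c s).projR : EuclideanSpace ℝ (Site P 0) →L[ℝ] EuclideanSpace ℝ (Site P 0)).toLinearMap ∘ₗ
    (opsV1 P k c s).dstar)

/-- Membership in `{A : R∂*A = 0}`. [cite: Balaban1984PropagatorsI, (1.47) p.26] -/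
theorem mem_lan (X : BondSpace P) : X ∈ lan P k c s ↔ (opsV1 P k c s).projR ((opsV1 P k c s).dstar X) = 0 := Iff.rfl

variable (P k c s) in
/-- **«the subspace {A′ : Q_kA′ = 0, R∂*A′ = 0}»** (p. 29): the direction space of the Landau-gauge fibre `{Q_kA = B, R∂*A = 0}` of (1.47).
[cite: Balaban1984PropagatorsI, (1.64) p.29] -/
def lanDir : Submodule ℝ (BondSpace P) := (opsV1 P k c s).kerQk ⊓ lan P k c s

/-- Membership in `{A′ : Q_kA′ = 0, R∂*A′ = 0}`. [cite: Balaban1984PropagatorsI, (1.64) p.29] -/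
theorem mem_lanDir (v : BondSpace P) :
    v ∈ lanDir P k c s ↔ (opsV1 P k c s).Qk v = 0 ∧ (opsV1 P k c s).projR ((opsV1 P k c s).dstar v) = 0 := by
  rw [lanDir, Submodule.mem_inf, LandauOps.mem_kerQk, mem_lan]

/-! ## 2. (1.47) based at `H_kB`, and (1.64): «we make the translation A = A′ + H_kB … (1.47) = Z_k exp(−½⟨∂H_kB, ∂H_kB⟩)» -/

variable (k c s) in
/-- **The integral of (1.47) on V1**: `∫dA δ(B − Q_kA)δ_R(∂*A) exp(−½⟨∂A, ∂A⟩)` — the integral of `e^{−½‖∂A‖²}` (`∂ = s·curl c`, `s² = η^d`) over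
the Landau-gauge fibre `{Q_kA = B, R∂*A = 0} = H_kB + {A′ : Q_kA′ = 0, R∂*A′ = 0}` for the volume measure of that subspace, written — as on p. 29,
«we make the translation A = A′ + H_kB» — at the base point `H_kB` (p11's Landau minimizer `Hk (opsV1 P k c s)` of (4.4.2), which lies on
this fibre: `Hk_isLandauMinimizer_V1`).  The printed prefactor `z′^{(k)}|det(Δ↾N(Q′_k))|` is not part of it. [cite: Balaban1984PropagatorsI, (1.47) p.26] -/
def rt47 (B : VecField P k ℝ) : ℝ :=
  ∫ v : ↥(lanDir P k c s), Real.exp (-(1 / 2 : ℝ) * ‖(opsV1 P k c s).curl (Hk (opsV1 P k c s) B + (v : BondSpace P))‖ ^ 2)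

variable (P k c s) in
/-- **`Z_k` of (1.64)**: `∫ e^{−½‖∂A′‖²} dA′` over `{A′ : Q_kA′ = 0, R∂*A′ = 0}`. [cite: Balaban1984PropagatorsI, (1.64) p.29] -/
def Zk47 : ℝ :=
  ∫ v : ↥(lanDir P k c s), Real.exp (-(1 / 2 : ℝ) * ‖(opsV1 P k c s).curl (v : BondSpace P)‖ ^ 2)

/-- **«⟨∂A′, ∂H_kB⟩ = 0 on the subspace {A′ : Q_kA′ = 0, R∂*A′ = 0}»** (p. 29), in the form used for (1.64):
`½‖∂(H_kB + A′)‖² = ½‖∂H_kB‖² + ½‖∂A′‖²` for every such `A′` — from the minimality of `H_kB` (p11's `Hk_spec_V1` +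
`LandauOps.energy_split_of_isMinOn`) and the Landau condition of both terms. [cite: Balaban1984PropagatorsI, (1.64) p.29] -/
theorem half_norm_curl_Hk_add_sq (hk : k ≤ P.m + P.K) (hc : c ≠ 0) (hs : s ≠ 0) (B : VecField P k ℝ) {v : BondSpace P}
    (hv : v ∈ lanDir P k c s) :
    (1 / 2 : ℝ) * ‖(opsV1 P k c s).curl (Hk (opsV1 P k c s) B + v)‖ ^ 2 =
      (1 / 2 : ℝ) * ‖(opsV1 P k c s).curl (Hk (opsV1 P k c s) B)‖ ^ 2 + (1 / 2 : ℝ) * ‖(opsV1 P k c s).curl v‖ ^ 2 := by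
  obtain ⟨hQ, hmin, -, -⟩ := Hk_spec_V1 hk hc hs B
  obtain ⟨-, hR, -⟩ := Hk_isLandauMinimizer_V1 hk hc hs B
  obtain ⟨hvQ, hvR⟩ := (mem_lanDir v).1 hv
  have hsplit := (opsV1 P k c s).energy_split_of_isMinOn hQ hmin hvQ
  have hR' : (opsV1 P k c s).projR ((opsV1 P k c s).dstar (Hk (opsV1 P k c s) B + v)) = 0 := by
    rw [map_add, map_add, hR, hvR, add_zero]
  simp only [LandauOps.energy, hR, hR', hvR, norm_zero, ne_eq, OfNat.ofNat_ne_zero, not_false_eq_true, zero_pow, mul_zero,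
    add_zero] at hsplit
  exact hsplit

/-- **(1.64) AS PRINTED, on V1**: «We make the translation A = A′ + H_kB and using the above properties of H_kB, we get
(1.47) = Z_k exp(−½⟨∂H_kB, ∂H_kB⟩).» — for every `B` (`k ≤ m + K`, `c ≠ 0`, `s ≠ 0`), with `Z_k = Zk47 k c s` independent of `B`.
[cite: Balaban1984PropagatorsI, (1.64) p.29] -/
theorem eq164 (hk : k ≤ P.m + P.K) (hc : c ≠ 0) (hs : s ≠ 0) (B : VecField P k ℝ) :
    rt47 k c s B = Zk47 P k c s * Real.exp (-(1 / 2 : ℝ) * ‖(opsV1 P k c s).curl (Hk (opsV1 P k c s) B)‖ ^ 2) := by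
  unfold rt47 Zk47
  rw [← integral_mul_const]
  refine integral_congr_ae (ae_of_all _ fun v => ?_)
  show Real.exp _ = Real.exp _ * Real.exp _
  rw [neg_mul, half_norm_curl_Hk_add_sq hk hc hs B v.2, ← Real.exp_add]
  congr 1
  ring

/-- **Base-point independence of the (1.47) integral**: for ANY configuration `A₀` of the Landau fibre over `B` (`Q_kA₀ = B`, `R∂*A₀ = 0`),
`∫ e^{−½‖∂(A₀ + A′)‖²}dA′` over `{A′ : Q_kA′ = 0, R∂*A′ = 0}` equals `rt47 k c s B` — translation invariance of the subspace volume
(`A₀ − H_kB` lies in that subspace), i.e. the delta-function integral of (1.47) does not depend on the chosen origin of the fibre.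
[cite: Balaban1984PropagatorsI, (1.47) p.26] -/
theorem rt47_eq_of_mem (hk : k ≤ P.m + P.K) (hc : c ≠ 0) (hs : s ≠ 0) {B : VecField P k ℝ} {A₀ : BondSpace P}
    (hQ : (opsV1 P k c s).Qk A₀ = B) (hR : (opsV1 P k c s).projR ((opsV1 P k c s).dstar A₀) = 0) :
    ∫ v : ↥(lanDir P k c s), Real.exp (-(1 / 2 : ℝ) * ‖(opsV1 P k c s).curl (A₀ + (v : BondSpace P))‖ ^ 2) = rt47 k c s B := by
  obtain ⟨hQH, hRH, -⟩ := Hk_isLandauMinimizer_V1 hk hc hs B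
  have hmem : A₀ - Hk (opsV1 P k c s) B ∈ lanDir P k c s := by
    simp only [mem_lanDir, map_sub, hQ, hQH, hR, hRH, sub_self, and_self]
  have h := integral_add_left_eq_self (μ := (volume : Measure ↥(lanDir P k c s)))
    (fun w : ↥(lanDir P k c s) => Real.exp (-(1 / 2 : ℝ) * ‖(opsV1 P k c s).curl (Hk (opsV1 P k c s) B + (w : BondSpace P))‖ ^ 2))
    (⟨A₀ - Hk (opsV1 P k c s) B, hmem⟩ : ↥(lanDir P k c s))
  have hpt : (Hk (opsV1 P k c s) B : BondSpace P) + ((⟨A₀ - Hk (opsV1 P k c s) B, hmem⟩ : ↥(lanDir P k c s)) : BondSpace P) = A₀ :=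
    add_sub_cancel _ _
  unfold rt47
  rw [← h]
  refine integral_congr_ae (ae_of_all _ fun v => ?_)
  show Real.exp _ = Real.exp _
  rw [Submodule.coe_add, ← add_assoc, hpt]

/-- `Z_k > 0`: «⟨∂A, ∂A⟩ is positive» on `{A′ : Q_kA′ = 0, R∂*A′ = 0}` (no zero modes of `∂` there: p11's `noZeroModes_V1` ⟸ [6I] p. 30), so the
Gaussian integral converges and is positive. [cite: Balaban1984PropagatorsI, (1.64) p.29] -/
theorem Zk47_pos (hk : k ≤ P.m + P.K) (hc : c ≠ 0) (hs : s ≠ 0) : 0 < Zk47 P k c s := by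
  set S : ↥(lanDir P k c s) →ₗ[ℝ] PlaqSpace P := (opsV1 P k c s).curl ∘ₗ (lanDir P k c s).subtype with hS
  have hinj : Function.Injective S := by
    rw [← LinearMap.ker_eq_bot, LinearMap.ker_eq_bot']
    intro v hv
    obtain ⟨hvQ, hvR⟩ := (mem_lanDir (v : BondSpace P)).1 v.2
    exact Subtype.ext (noZeroModes_V1 hk hc hs (v : BondSpace P) hvQ hv hvR)
  exact Literature.MathematicalPhysics.QuantumFieldTheory.BalabanImbrieJaffe1984to88.BIJ85AxialPropagator411.partition_pos hinj

/-! ## 3. (1.47) on V1: `((ST)^k e^{−S})(B) = z″^{(k)}·∫dA δ(B − Q_kA)δ_R(∂*A)e^{−½⟨∂A,∂A⟩}` -/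

/-- **(1.47) ON THE V1 CALCULUS** (with (1.64)/(1.65) and the axial Gaussian (1.19)): for `S = ½Σ_p s²|(∂A)(p)|²` (`curlAction (s²) c`), `k ≤ m + K`,
`c ≠ 0`, `s ≠ 0`, there is ONE `z″ > 0` with `((ST)^k e^{−S})(B) = z″ · ∫dA δ(B − Q_kA)δ_R(∂*A)e^{−S(A)}` for all `B` — here by evaluating both
sides: `(ST)^k e^{−S} = Z_{k,Ax}e^{−½⟨B,Δ_kB⟩}` (`B5Eq119GaussianV1.eq119`), `⟨B,Δ_kB⟩ = ‖∂H_kB‖²` ((1.65), `B5Eq165GaugeMinimaV1.eq165_landau`) and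
(1.64) (`eq164`); the printed route through (1.23)/(1.46) (the δ_R slice of the Faddeev–Popov formula) is `eq147_of_eq123` (§4).
[cite: Balaban1984PropagatorsI, (1.47) p.26] -/
theorem eq147 (hk : k ≤ P.m + P.K) (hc : c ≠ 0) (hs : s ≠ 0) :
    ∃ z : ℝ, 0 < z ∧ ∀ B : VecField P k ℝ, rtPow k (fun A => Real.exp (-curlAction (s ^ 2) c A)) B = z * rt47 k c s B := by
  have hw : (0 : ℝ) < s ^ 2 := by positivity
  refine ⟨zAx P k (s ^ 2) c / Zk47 P k c s, div_pos (zAx_pos hk hw hc) (Zk47_pos hk hc hs), fun B => ?_⟩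
  rw [eq119 hk hw hc B, eq164 hk hc hs B, ← mul_assoc, div_mul_cancel₀ _ (Zk47_pos hk hc hs).ne', neg_mul, neg_mul,
    B5Eq165GaugeMinimaV1.eq165_landau hk hc hs B]

/-! ## 4. (1.46) on V1, and the printed route (1.23) → (1.46)/(1.47): the Landau δ-function `δ_R(∂*A)` «introduced from the beginning» -/

section FromEq123

open B5Eq123ChangeOfGaugeV1
open B5GaussSectC (detN Rop Rsub)

/-- **(1.46) ON V1** — «We may introduce this gauge from the beginning using the equation ∫dλ δ(Q′_kλ)|det(Δ↾_{N(Q′_k)})|δ_R(∂*A − Δλ) = 1.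
(1.46)»: for an ARBITRARY regularisation `φ` of `δ_R` (any profile on the Euclidean site-function space) and every field `A`,
`∫_{N(Q′_k)} |det(Δ↾N(Q′_k))| φ(R ∂*A^λ) dλ = ∫_R φ(μ)dμ` (`∂*A^λ = ∂*A − Δλ`), independently of `A`; with `∫_R φ = 1` this is (1.46).
The tree's p22 statement `B5GaussSectC.integral_146` ((1.40) + invariance of the Lebesgue measure of `R = ΔN(Q′_k)`) instantiated on the unit
lattice: `N = N(Q′_k)` (`resid`), `Δ` the Laplacian of `opsV1 P k c 1`, injective on `N(Q′_k)` (`injOn_lap_resid`). [cite: Balaban1984PropagatorsI, (1.46) p.26] -/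
theorem eq146 (k : ℕ) {c : ℝ} (hc : c ≠ 0) {F : Type*} [NormedAddCommGroup F] [NormedSpace ℝ F] (φ : SiteSpace P → F)
    (A : VecField P 0 ℝ) :
    ∫ l : ↥(resid P k), detN (resid P k) ((opsV1 P k c 1).lap : SiteSpace P →ₗ[ℝ] SiteSpace P) •
        φ (Rop (resid P k) ((opsV1 P k c 1).lap : SiteSpace P →ₗ[ℝ] SiteSpace P)
          (WithLp.toLp 2 (diverg c (gaugeShift c (WithLp.ofLp (l : SiteSpace P)) A)))) =
      ∫ y : ↥(Rsub (resid P k) ((opsV1 P k c 1).lap : SiteSpace P →ₗ[ℝ] SiteSpace P)), φ y := by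
  rw [← B5GaussSectC.integral_146 (injOn_lap_resid k hc) φ (WithLp.toLp 2 (diverg c A))]
  refine integral_congr_ae (ae_of_all _ fun l => ?_)
  show _ • φ _ = _ • φ _
  rw [toLp_diverg_gaugeShift k]

variable (P) in
/-- `(A′, λ) ↦ A′ − ∂λ`: Landau direction and residual gauge parameter to a bond field. [cite: Balaban1984PropagatorsI, (1.47) p.26] -/
def psiFun (k : ℕ) (c s : ℝ) : (↥(lanDir P k c s) × ↥(resid P k)) →ₗ[ℝ] BondSpace P :=
  (lanDir P k c s).subtype ∘ₗ LinearMap.fst ℝ _ _ - gradV1 P c ∘ₗ (resid P k).subtype ∘ₗ LinearMap.snd ℝ _ _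

/-- values of `psiFun`. [cite: Balaban1984PropagatorsI, (1.47) p.26] -/
theorem psiFun_apply (c s : ℝ) (p : ↥(lanDir P k c s) × ↥(resid P k)) :
    psiFun P k c s p = (p.1 : BondSpace P) - gradV1 P c (p.2 : SiteSpace P) := rfl

/-- `A′ − ∂λ` is a fibre direction: `Q_k(A′ − ∂λ) = Q_kA′ − ∂^{(k)}Q′_kλ = 0` ((1.20)). [cite: Balaban1984PropagatorsI, (1.20) p.20] -/
theorem psiFun_mem (hk : k ≤ P.m + P.K) (c s : ℝ) (p : ↥(lanDir P k c s) × ↥(resid P k)) : psiFun P k c s p ∈ fdir P k := by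
  have hl : (opsV1 P k c s).Qp (p.2 : SiteSpace P) = 0 := (LandauOps.mem_kerQp _).1 p.2.2
  obtain ⟨hQ1, -⟩ := (mem_lanDir (p.1 : BondSpace P)).1 p.1.2
  show psiFun P k c s p ∈ (opsV1 P k c s).kerQk
  rw [LandauOps.mem_kerQk, psiFun_apply, map_sub, (gaugeStructure_V1 hk c s).Qk_grad _ hl, hQ1, sub_zero]

variable (P) in
/-- **The Landau slice ⊕ orbit coordinates** `(A′, λ) ↦ A′ − ∂λ` into `N(Q_k)`. [cite: Balaban1984PropagatorsI, (1.47) p.26] -/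
def psi (hk : k ≤ P.m + P.K) (c s : ℝ) : (↥(lanDir P k c s) × ↥(resid P k)) →ₗ[ℝ] ↥(fdir P k) :=
  LinearMap.codRestrict (fdir P k) (psiFun P k c s) (psiFun_mem hk c s)

/-- values of the coordinates. [cite: Balaban1984PropagatorsI, (1.47) p.26] -/
theorem psi_apply_coe (hk : k ≤ P.m + P.K) (c s : ℝ) (p : ↥(lanDir P k c s) × ↥(resid P k)) :
    (psi P hk c s p : BondSpace P) = (p.1 : BondSpace P) - gradV1 P c (p.2 : SiteSpace P) := rfl

/-- INJECTIVITY of the coordinates = uniqueness of the Landau gauge along a residual orbit: a pure gauge `∂λ`, `λ ∈ N(Q′_k)`, with `R∂*∂λ = RΔλ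
= Δλ = 0` has `λ = 0` («the operator Δ is positive definite on N(Q′_k), thus invertible», p. 25; `lapInjective_V1`). [cite: Balaban1984PropagatorsI, (1.47) p.26] -/
theorem psi_injective (hk : k ≤ P.m + P.K) (hc : c ≠ 0) (hs : s ≠ 0) : Function.Injective (psi P hk c s) := by
  rw [← LinearMap.ker_eq_bot, LinearMap.ker_eq_bot']
  rintro ⟨m, l⟩ h
  have h0 : (m : BondSpace P) - gradV1 P c (l : SiteSpace P) = 0 := by
    have h' := congrArg Subtype.val h
    rwa [psi_apply_coe] at h'
  have hl : (opsV1 P k c s).Qp (l : SiteSpace P) = 0 := (LandauOps.mem_kerQp _).1 l.2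
  obtain ⟨-, hR⟩ := (mem_lanDir (m : BondSpace P)).1 m.2
  rw [sub_eq_zero.mp h0, (gaugeStructure_V1 hk c s).dstar_grad, (opsV1 P k c s).projR_lap_of_mem hl] at hR
  have hl0 : (l : SiteSpace P) = 0 := lapInjective_V1 k hc hs _ hl hR
  have hm : (m : BondSpace P) = 0 := by rw [sub_eq_zero.mp h0, hl0, map_zero]
  ext1
  · exact Subtype.ext hm
  · exact Subtype.ext hl0

/-- SURJECTIVITY of the coordinates = existence of the Landau gauge (gen-2 `B5Eq165GaugeMinimaV1.exists_landau_gauge`: `R∂*A ∈ ΔN(Q′_k)`):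
every `n` with `Q_kn = 0` is `(n − ∂λ) − ∂(−λ)` with `R∂*(n − ∂λ) = 0`, `Q′_kλ = 0`, `Q_k(n − ∂λ) = 0`. [cite: Balaban1984PropagatorsI, (1.47) p.26] -/
theorem psi_surjective (hk : k ≤ P.m + P.K) (c s : ℝ) : Function.Surjective (psi P hk c s) := by
  rintro ⟨n, hn⟩
  obtain ⟨l, hl, hR⟩ := B5Eq165GaugeMinimaV1.exists_landau_gauge hk c s n
  have hQn : (opsV1 P k c s).Qk n = 0 := (LandauOps.mem_kerQk _).1 hn
  have hm : n - gradV1 P c l ∈ lanDir P k c s := by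
    rw [mem_lanDir, map_sub, hQn, (gaugeStructure_V1 hk c s).Qk_grad _ hl, sub_zero]
    exact ⟨rfl, hR⟩
  have hl' : l ∈ resid P k := (LandauOps.mem_kerQp _).2 hl
  refine ⟨(⟨n - gradV1 P c l, hm⟩, -⟨l, hl'⟩), Subtype.ext ?_⟩
  rw [psi_apply_coe]
  show n - gradV1 P c l - gradV1 P c (-l) = n
  rw [map_neg, sub_neg_eq_add, sub_add_cancel]

variable (P) in
/-- **the Landau coordinates as a continuous linear equivalence `{A′ : Q_kA′ = 0, R∂*A′ = 0} × N(Q′_k) ≃ N(Q_k)`** — the change of variables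
behind «(1.23) with δ_R inserted by (1.46)» = (1.47), with constant Jacobian. [cite: Balaban1984PropagatorsI, (1.47) p.26] -/
def coordsL (hk : k ≤ P.m + P.K) (hc : c ≠ 0) (hs : s ≠ 0) : (↥(lanDir P k c s) × ↥(resid P k)) ≃L[ℝ] ↥(fdir P k) :=
  (LinearEquiv.ofBijective (psi P hk c s) ⟨psi_injective hk hc hs, psi_surjective hk c s⟩).toContinuousLinearEquiv

/-- values of the Landau coordinates. [cite: Balaban1984PropagatorsI, (1.47) p.26] -/
theorem coordsL_apply_coe (hk : k ≤ P.m + P.K) (hc : c ≠ 0) (hs : s ≠ 0) (m : ↥(lanDir P k c s)) (l : ↥(resid P k)) :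
    (coordsL P hk hc hs (m, l) : BondSpace P) = (m : BondSpace P) - gradV1 P c (l : SiteSpace P) := by
  rw [coordsL, LinearEquiv.coe_toContinuousLinearEquiv', LinearEquiv.ofBijective_apply, psi_apply_coe]

/-- the Feynman-gauge weight `e^{−(1/2α)⟨∂*A,∂*A⟩}` (`w = s²`) as a function on the Euclidean bond-field space (plumbing). [folklore] -/
private def gW (c s α : ℝ) (X : BondSpace P) : ℝ := Real.exp (-divergenceForm (s ^ 2) c α (WithLp.ofLp X))

/-- unfolding `gW`. [folklore] -/
private theorem gW_apply (c s α : ℝ) (X : BondSpace P) : gW c s α X = Real.exp (-divergenceForm (s ^ 2) c α (WithLp.ofLp X)) := rfl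

/-- `gW` is continuous. [folklore] -/
private theorem continuous_gW (c s α : ℝ) : Continuous (gW (P := P) c s α) :=
  Real.continuous_exp.comp ((continuous_divergenceForm (s ^ 2) c α).comp (PiLp.continuous_ofLp 2 _)).neg

/-- the density `e^{−S}`, `S = ½Σ_p s²|(∂A)(p)|²`, as a function on the Euclidean bond-field space (plumbing). [folklore] -/
private def rhoS (c s : ℝ) (X : BondSpace P) : ℝ := Real.exp (-curlAction (s ^ 2) c (WithLp.ofLp X))

/-- unfolding `rhoS`. [folklore] -/
private theorem rhoS_apply (c s : ℝ) (X : BondSpace P) : rhoS c s X = Real.exp (-curlAction (s ^ 2) c (WithLp.ofLp X)) := rfl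

/-- `rhoS` is continuous. [folklore] -/
private theorem continuous_rhoS (c s : ℝ) : Continuous (rhoS (P := P) c s) :=
  Real.continuous_exp.comp ((continuous_curlAction (s ^ 2) c).comp (PiLp.continuous_ofLp 2 _)).neg

/-- **(1.23) ⟹ (1.47) on V1 — the Landau δ-function in place of the Feynman-gauge weight.**  For `S = ½Σ_p s²|(∂A)(p)|²`, `k ≤ m + K`, `c ≠ 0`,
`s ≠ 0` there is ONE constant `C > 0` (the Jacobian of `coordsL`) such that for EVERY `α > 0` and every `B`
`∫dA δ(B − Q_kA)δ_R(∂*A)e^{−S(A)} = C · ∫dA δ(B − Q_kA) e^{−(1/2α)⟨∂*A,∂*A⟩}(∫dλ δ(Q′_kλ)e^{−(1/2α)⟨∂*A^λ,∂*A^λ⟩})⁻¹ e^{−S(A)}`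
(`rt47 = C·rt23`): the (1.23) integral with its Faddeev–Popov unit `∫dλ δ(Q′_kλ)𝒢_α(∂*A^λ) = 1` (p. 25) traded for the unit (1.46) — the same
Fubini / gauge-invariance / translation manœuvre as (1.17) → (1.23) (p22's engine `B5ChangeOfGauge123.eq123_zprime`), now fed with the Landau
coordinates `coordsL`, the invariance of `e^{−S}` under `A ↦ A^λ` and (1.22) `> 0` (`fp22_pos`). [cite: Balaban1984PropagatorsI, (1.47) p.26] -/
theorem rt47_eq_const_mul_rt23 (hk : k ≤ P.m + P.K) (hc : c ≠ 0) (hs : s ≠ 0) :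
    ∃ C : ℝ, 0 < C ∧ ∀ {α : ℝ}, 0 < α → ∀ B : VecField P k ℝ,
      rt47 k c s B = C * rt23 k (s ^ 2) c α (fun A => Real.exp (-curlAction (s ^ 2) c A)) B := by
  haveI : ((volume : Measure ↥(lanDir P k c s)).prod (volume : Measure ↥(resid P k))).IsAddHaarMeasure :=
    Measure.prod.instIsAddHaarMeasure _ _
  have he : ∀ (m : ↥(lanDir P k c s)) (l : ↥(resid P k)), (fdir P k).subtype (coordsL P hk hc hs (m, l)) =
      (lanDir P k c s).subtype m - (gradV1 P c ∘ₗ (resid P k).subtype) l := fun m l => by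
    rw [Submodule.subtype_apply, coordsL_apply_coe]; rfl
  obtain ⟨C, hC, h⟩ := B5ChangeOfGauge123.eq123_zprime (volume : Measure ↥(lanDir P k c s)) (volume : Measure ↥(resid P k))
    (volume : Measure ↥(fdir P k)) (coordsL P hk hc hs) (lanDir P k c s).subtype (fdir P k).subtype
    (gradV1 P c ∘ₗ (resid P k).subtype) he
  refine ⟨C, hC, fun {α} hα B => ?_⟩
  have hw : (0 : ℝ) < s ^ 2 := by positivity
  -- the data: Feynman-gauge weight `gW`, density `rhoS = e^{−S}`, base point `H_kB`
  have hD : ∀ l : ↥(resid P k), (gradV1 P c ∘ₗ (resid P k).subtype) l = gradV1 P c (l : SiteSpace P) := fun l => rfl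
  -- the orbit integral of `g` through `X` is (1.22)'s integral at `X`
  have horbit : ∀ X : BondSpace P, ∫ l : ↥(resid P k), gW c s α (X - (gradV1 P c ∘ₗ (resid P k).subtype) l) =
      fp22 k (s ^ 2) c α (WithLp.ofLp X) := fun X => by
    unfold fp22
    refine integral_congr_ae (ae_of_all _ fun l => ?_)
    show gW c s α _ = Real.exp _
    rw [gW_apply, hD, ofLp_sub_gradV1]
  have h1 := h (Hk (opsV1 P k c s) B) (gW c s α) (rhoS c s) 1 (fun X => (Real.exp_pos _).le) (fun X => (Real.exp_pos _).le)
    (((continuous_gW c s α).comp (((continuous_const.add continuous_subtype_val).comp continuous_fst).sub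
      ((gradV1 P c ∘ₗ (resid P k).subtype).continuous_of_finiteDimensional.comp continuous_snd))).aestronglyMeasurable)
    (((continuous_rhoS c s).comp (continuous_const.add continuous_subtype_val)).aestronglyMeasurable)
    (fun m l => by rw [rhoS_apply, rhoS_apply, hD, ofLp_sub_gradV1, curlAction_gaugeShift])
    (fun m => by rw [horbit]; exact (fp22_pos k hw hc hα _).ne')
  rw [one_mul, one_mul] at h1
  simp only [Submodule.subtype_apply] at h1
  -- read off the two sides: the Landau-fibre integral of `e^{−S}` …
  have hL : rt47 k c s B = ∫ m : ↥(lanDir P k c s), rhoS c s (Hk (opsV1 P k c s) B + (m : BondSpace P)) := by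
    unfold rt47
    refine integral_congr_ae (ae_of_all _ fun m => ?_)
    show Real.exp _ = rhoS c s _
    rw [rhoS_apply, neg_mul, B5Eq165GaugeMinimaV1.half_norm_curl_sq k c s]
  -- … and the (1.23) integral based at `H_kB`
  have hQa : (opsV1 P k c s).Qk (Hk (opsV1 P k c s) B) = B := (Hk_isLandauMinimizer_V1 hk hc hs B).1
  have hR : rt23 k (s ^ 2) c α (fun A => Real.exp (-curlAction (s ^ 2) c A)) B =
      ∫ n : ↥(fdir P k), gW c s α (Hk (opsV1 P k c s) B + (n : BondSpace P)) *
        (∫ l : ↥(resid P k), gW c s α (Hk (opsV1 P k c s) B + (n : BondSpace P) - (gradV1 P c ∘ₗ (resid P k).subtype) l))⁻¹ *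
          rhoS c s (Hk (opsV1 P k c s) B + (n : BondSpace P)) := by
    have hpt : ∀ n : ↥(fdir P k), fpWeight k (s ^ 2) c α (WithLp.ofLp (Hk (opsV1 P k c s) B + (n : BondSpace P))) *
        Real.exp (-curlAction (s ^ 2) c (WithLp.ofLp (Hk (opsV1 P k c s) B + (n : BondSpace P)))) =
        gW c s α (Hk (opsV1 P k c s) B + (n : BondSpace P)) *
          (∫ l : ↥(resid P k), gW c s α (Hk (opsV1 P k c s) B + (n : BondSpace P) - (gradV1 P c ∘ₗ (resid P k).subtype) l))⁻¹ *
            rhoS c s (Hk (opsV1 P k c s) B + (n : BondSpace P)) := fun n => by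
      rw [horbit, gW_apply, rhoS_apply, fpWeight]
    rw [rt23_eq_fibInt hk (s ^ 2) c α s, fibInt_eq_of_mem (opsV1 P k c s) _ hQa]
    exact integral_congr_ae (ae_of_all _ hpt)
  rw [hL, hR, h1]

/-- **(1.47) BY THE PRINTED ROUTE, on V1**: (1.17) (`B5Eq117CompositionV1`) → (1.23) (`B5Eq123ChangeOfGaugeV1.eq123`, any `α > 0`) → (1.46)
inserted (`rt47_eq_const_mul_rt23`): ONE `z″^{(k)} > 0` with `((ST)^k e^{−S})(B) = z″·∫dA δ(B − Q_kA)δ_R(∂*A)e^{−S(A)}` for all `B` — the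
printed prefactor `z′^{(k)}|det(Δ↾N(Q′_k))|` and the Jacobian lumped in `z″`.  Same statement as `eq147` (there via (1.19)/(1.64)/(1.65)).
[cite: Balaban1984PropagatorsI, (1.47) p.26] -/
theorem eq147_of_eq123 (hk : k ≤ P.m + P.K) (hc : c ≠ 0) (hs : s ≠ 0) :
    ∃ z : ℝ, 0 < z ∧ ∀ B : VecField P k ℝ, rtPow k (fun A => Real.exp (-curlAction (s ^ 2) c A)) B = z * rt47 k c s B := by
  have hw : (0 : ℝ) < s ^ 2 := by positivity
  obtain ⟨z', hz', h123⟩ := B5Eq123ChangeOfGaugeV1.eq123 (P := P) hk hw hc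
  obtain ⟨C, hC, h47⟩ := rt47_eq_const_mul_rt23 (P := P) hk hc hs
  refine ⟨z' / C, div_pos hz' hC, fun B => ?_⟩
  rw [h123 one_pos B, h47 one_pos B, ← mul_assoc, div_mul_cancel₀ _ hC.ne']

/-- **B5 (1.47) integral ∝ [BalabanImbrieJaffe1985] (4.4.3) `Z_k(B)`** on V1: `∫dA δ(B − Q_kA)δ_R(∂*A)e^{−S(A)} = C·Z_k(B)` with ONE `C > 0` — the
Landau δ-function `δ_R` and its Gaussian regularisation `𝒢(∂*A)` give proportional fibre integrals (`rt47_eq_const_mul_rt23` at `α = 1` and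
`B5Eq123ChangeOfGaugeV1.rt23_eq_Zk`). [cite: BalabanImbrieJaffe1985, (4.4.3) p.312] -/
theorem rt47_eq_const_mul_Zk (hk : k ≤ P.m + P.K) (hc : c ≠ 0) (hs : s ≠ 0) :
    ∃ C : ℝ, 0 < C ∧ ∀ B : VecField P k ℝ, rt47 k c s B = C * Zk (opsV1 P k c s) B := by
  obtain ⟨C, hC, h47⟩ := rt47_eq_const_mul_rt23 (P := P) hk hc hs
  exact ⟨C, hC, fun B => by rw [h47 one_pos B, rt23_eq_Zk hk]⟩

end FromEq123

end

end B5Eq164LandauV1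

end Literature.MathematicalPhysics.QuantumFieldTheory.Balaban1983to89
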